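import Mathlib.CategoryTheory.Types.Basic
import Mathlib.CategoryTheory.Discrete.Basic
import Mathlib.CategoryTheory.Limits.Shapes.IsTerminal
import Mathlib.Order.Interval.Set.OrdConnected
import Literature.AlgebraicGeometry.Frobenioids.Dissection
import HarnessLib

/-!
# Frobenioids II, §0 pp. 5–6: the category "types" `IsOfWeaklyDissectibleType`,
# `IsOfTotallyOrderedType`, `IsOfQuasiTotallyOrderedType` (FACT-LIST F-2328 / F-2333 / F-2334) —
# universal closures REFUTED, model categories supplied

Mochizuki, *The geometry of Frobenioids II: poly-Frobenioids*, Kyushu J. Math. **62** (2008) 401–460,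
§0 "Notations and Conventions", paragraph **Categories**, kurims text pp. 5–6
[cite: MochizukiFrdII2008, §0 pp.5-6]: "If every object of `C` is weakly dissectible, then we shall say
that `C` is *of weakly dissectible type*" (p. 5); "We shall say that `C` is a category *of totally
ordered type* (respectively, *of quasi-totally ordered type*) if every arrow of `C` is totally ordered
(respectively, quasi-totally ordered)" (p. 6), where a monomorphism `φ` is totally ordered when the
category `C^↣_φ` of its factorizations through monomorphisms is equivalent to `Order(E)` for a totally
ordered set `E` (p. 6).

PROOF-ONLY companion of `Dissection.lean` (no definitions, no instances, no notation; abc-iut cell,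
seat abc-iut-f-031, FACT-LIST rows **F-2328** `IsOfWeaklyDissectibleType`, **F-2333**
`IsOfTotallyOrderedType`, **F-2334** `IsOfQuasiTotallyOrderedType`, class `preparatory`,
kernel_closedness `parametrised`).  The three rows are DEFINITIONS of §0 — predicates on an arbitrary
category `C` ("we shall say that …") — not claims; print asserts them of specific categories only
([FrdII] Thm. 3.6 (viii): `F[ℂ]` is of weakly dissectible type, PROVED in the tree as
`ArchFrd.thm36viii_C` / `ArchFrd.thm36viii_A`; [EtTh] Rmk. 3.7.1, PROVED as
`TemperedFrobenioid.remark371_holds`).  Their universal closures ("every category is of … type") are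
false; this file supplies the kernel objects saying so, together with model categories showing that each
notion is inhabited:

* `not_isOfWeaklyDissectibleType_discretePUnit`: in the terminal category `Discrete PUnit` the object
  is initial, hence not "nonempty", hence admits no dissecting pair; so
  `not_forall_isOfWeaklyDissectibleType` (F-2328).  Model: the full subcategory of `Type u` on the
  types with two distinct elements IS of weakly dissectible type (two constant self-maps with distinct
  values weakly dissect), `isOfWeaklyDissectibleType_nontrivialType` — and is NOT of strongly
  dissectible type, `not_isOfStronglyDissectibleType_nontrivialType`, so the printed implication
  "strongly dissectible ⇒ weakly dissectible" (`IsOfStronglyDissectibleType.isOfWeaklyDissectibleType`)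
  is strict.
* `not_isOfTotallyOrderedType_type`, `not_isOfQuasiTotallyOrderedType_type`: in `Type u` the map
  `ULift Bool → PUnit` is not a monomorphism; so `not_forall_isOfTotallyOrderedType` (F-2333) and
  `not_forall_isOfQuasiTotallyOrderedType` (F-2334).  Model: for a totally ordered set `E` the category
  `Order(E)` itself is of totally ordered type — `Order(E)^↣_{a → b} ≃ Order([a, b])`,
  `isOfTotallyOrderedType_of_linearOrder` — hence of quasi-totally ordered type
  (`isOfQuasiTotallyOrderedType_of_linearOrder`), and of continuously ordered type when `E` is densely
  ordered (`isOfContinuouslyOrderedType_of_denselyOrdered`).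

The forms the tree consumes are the printed implications, already kernel theorems of `Dissection.lean`
(`IsOfStronglyDissectibleType.isOfWeaklyDissectibleType`,
`IsOfContinuouslyOrderedType.isOfTotallyOrderedType`, `IsOfTotallyOrderedType.isOfQuasiTotallyOrderedType`)
and the instance theorems named above.  So each row is admissible ONLY as vocabulary / in instance form
(FACT-LIST class «universal-closure REFUTED; instance forms in tree»).  Elementary category theory;
nothing here bears on the disputed [IUTchIII] Cor. 3.12 or takes a side; refuted is never a fact.
-/

namespace Literature.AlgebraicGeometry.Frobenioids

open CategoryTheory CategoryTheory.Limits

universe u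

/-! ### F-2328 `IsOfWeaklyDissectibleType`: refuted at `Discrete PUnit`, modelled by the nontrivial types -/

section WeaklyDissectibleType

/-- In the terminal category `Discrete PUnit` (one object, one arrow) every object is initial, so no
object is "nonempty" (= non-initial, [FrdI] §0 p. 15). [cite: MochizukiFrdII2008, §0 p.5] -/
theorem not_isNonemptyObj_discretePUnit (X : Discrete PUnit.{u + 1}) : ¬ IsNonemptyObj X :=
  fun hX => @IsEmpty.false _ hX
    (IsInitial.ofUniqueHom (fun Y => eqToHom (Subsingleton.elim X Y)) fun _ _ => Subsingleton.elim _ _)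

/-- **F-2328 at the category `Discrete PUnit`: false.**  A weakly dissecting pair `{A_i → A}` has
non-initial domains, and `Discrete PUnit` has no non-initial object. [cite: MochizukiFrdII2008, §0 p.5] -/
theorem not_isOfWeaklyDissectibleType_discretePUnit :
    ¬ IsOfWeaklyDissectibleType (Discrete PUnit.{u + 1}) := by
  rintro ⟨h⟩
  obtain ⟨X, φ, hX, -⟩ := h ⟨PUnit.unit⟩
  exact not_isNonemptyObj_discretePUnit (X 0) (hX 0)

/-- **FACT-LIST F-2328, universal closure REFUTED** (witness category: `Discrete PUnit`).  The consumed
forms — the implication `IsOfStronglyDissectibleType.isOfWeaklyDissectibleType` and the instances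
`ArchFrd.thm36viii_C` / `ArchFrd.thm36viii_A` ([FrdII] Thm. 3.6 (viii)) and
`TemperedFrobenioid.isOfWeaklyDissectibleType_category` ([EtTh] Rmk. 3.7.1) — are theorems of the tree.
[cite: MochizukiFrdII2008, §0 p.5] -/
theorem not_forall_isOfWeaklyDissectibleType :
    ¬ ∀ (C : Type u) [Category.{u} C],
        Literature.AlgebraicGeometry.Frobenioids.IsOfWeaklyDissectibleType C :=
  fun h => not_isOfWeaklyDissectibleType_discretePUnit.{u} (h (Discrete PUnit.{u + 1}))

/-- In the full subcategory of `Type u` on the types with two distinct elements no object is initial: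
an initial `A` would have a unique self-map, but the constant maps at `a₀ ≠ a₁` differ.
[cite: MochizukiFrdII2008, §0 p.5] -/
theorem isNonemptyObj_nontrivialType (A : (ObjectProperty.FullSubcategory (Nontrivial : ObjectProperty (Type u)))) :
    IsNonemptyObj A := by
  haveI := A.property
  obtain ⟨a₀, a₁, hne⟩ := exists_pair_ne A.obj
  refine ⟨fun hI => hne ?_⟩
  have h := congrArg (fun f : A ⟶ A => f.hom a₀)
    (hI.hom_ext (ObjectProperty.homMk (TypeCat.ofHom fun _ => a₀))
      (ObjectProperty.homMk (TypeCat.ofHom fun _ => a₁)))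
  exact h

/-- **F-2328, a model category:** the full subcategory of `Type u` on the types with two distinct
elements is of weakly dissectible type — for `a₀ ≠ a₁` in `A` the two constant maps `A → A` weakly
dissect `A` (no map from an inhabited type equalizes them). [cite: MochizukiFrdII2008, §0 p.5] -/
theorem isOfWeaklyDissectibleType_nontrivialType :
    IsOfWeaklyDissectibleType (ObjectProperty.FullSubcategory (Nontrivial : ObjectProperty (Type u))) := by
  refine ⟨fun A => ?_⟩
  haveI := A.property
  obtain ⟨a₀, a₁, hne⟩ := exists_pair_ne A.obj
  let c : Fin 2 → A.obj := fun i => if i = 0 then a₀ else a₁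
  refine ⟨fun _ => A,
    fun i => ObjectProperty.homMk (TypeCat.ofHom fun _ => c i),
    fun _ => isNonemptyObj_nontrivialType A, ?_⟩
  intro i j hij B _ ψi ψj heq
  haveI := B.property
  obtain ⟨b⟩ := (inferInstance : Nonempty B.obj)
  have hc : c i = c j := congrArg (fun f : B ⟶ A => f.hom b) heq
  have key : ∀ i j : Fin 2, i ≠ j → (i = 0 ∧ ¬ j = 0) ∨ (¬ i = 0 ∧ j = 0) := by decide
  rcases key i j hij with ⟨hi, hj⟩ | ⟨hi, hj⟩
  · simp only [c, if_pos hi, if_neg hj] at hc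
    exact hne hc
  · simp only [c, if_neg hi, if_pos hj] at hc
    exact hne hc.symm

/-- The same model is NOT of strongly dissectible type (every inhabited type maps to every object), so
the printed implication "strongly dissectible type ⇒ weakly dissectible type"
(`IsOfStronglyDissectibleType.isOfWeaklyDissectibleType`) is strict. [cite: MochizukiFrdII2008, §0 p.5] -/
theorem not_isOfStronglyDissectibleType_nontrivialType :
    ¬ IsOfStronglyDissectibleType (ObjectProperty.FullSubcategory (Nontrivial : ObjectProperty (Type u))) := by
  rintro ⟨h⟩
  obtain ⟨X, φ, hX, hsd⟩ := h ⟨ULift.{u} Bool, ⟨⟨true⟩, ⟨false⟩, by decide⟩⟩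
  haveI := (X 1).property
  obtain ⟨x₁⟩ := (inferInstance : Nonempty (X 1).obj)
  exact hsd Fin.zero_ne_one (hX 0)
    ⟨⟨𝟙 _⟩, ⟨ObjectProperty.homMk (TypeCat.ofHom fun _ => x₁)⟩⟩

end WeaklyDissectibleType

/-! ### F-2333 / F-2334 `IsOf(Quasi)TotallyOrderedType`: refuted at `Type u` -/

section Types

/-- The constant map `ULift Bool → PUnit` of `Type u` is not a monomorphism (it is not injective).
[cite: MochizukiFrdII2008, §0 p.6] -/
theorem not_mono_ulift_bool_to_punit :
    ¬ Mono (TypeCat.ofHom fun _ : ULift.{u} Bool => PUnit.unit.{u + 1}) := by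
  rw [CategoryTheory.ofHom_mono_iff_injective]
  intro h
  exact absurd (@h ⟨true⟩ ⟨false⟩ rfl) (by decide)

/-- **F-2333 at the category `Type u`: false** — not every map of types is a monomorphism, let alone a
totally ordered one. [cite: MochizukiFrdII2008, §0 p.6] -/
theorem not_isOfTotallyOrderedType_type : ¬ IsOfTotallyOrderedType (Type u) :=
  fun h => not_mono_ulift_bool_to_punit (h.isTotallyOrderedHom _).1

/-- **F-2334 at the category `Type u`: false** — a quasi-totally ordered arrow is in particular a
monomorphism. [cite: MochizukiFrdII2008, §0 p.6] -/
theorem not_isOfQuasiTotallyOrderedType_type : ¬ IsOfQuasiTotallyOrderedType (Type u) :=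
  fun h => not_mono_ulift_bool_to_punit (h.isQuasiTotallyOrderedHom _).1

/-- **FACT-LIST F-2333, universal closure REFUTED** (witness category: `Type u`).  The consumed form —
the implication `IsOfContinuouslyOrderedType.isOfTotallyOrderedType` — is a theorem of the tree; a model
is `isOfTotallyOrderedType_of_linearOrder` below. [cite: MochizukiFrdII2008, §0 p.6] -/
theorem not_forall_isOfTotallyOrderedType :
    ¬ ∀ (C : Type (u + 1)) [Category.{u} C],
        Literature.AlgebraicGeometry.Frobenioids.IsOfTotallyOrderedType C :=
  fun h => not_isOfTotallyOrderedType_type.{u} (h (Type u))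

/-- **FACT-LIST F-2334, universal closure REFUTED** (witness category: `Type u`).  The consumed form —
the implication `IsOfTotallyOrderedType.isOfQuasiTotallyOrderedType` — is a theorem of the tree; a model
is `isOfQuasiTotallyOrderedType_of_linearOrder` below. [cite: MochizukiFrdII2008, §0 p.6] -/
theorem not_forall_isOfQuasiTotallyOrderedType :
    ¬ ∀ (C : Type (u + 1)) [Category.{u} C],
        Literature.AlgebraicGeometry.Frobenioids.IsOfQuasiTotallyOrderedType C :=
  fun h => not_isOfQuasiTotallyOrderedType_type.{u} (h (Type u))

end Types

/-! ### The model `Order(E)` of a totally ordered set `E` (p. 6) -/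

section Order

variable {E : Type u} [LinearOrder E]

/-- For `a ≤ b` in a totally ordered set `E`, the category `Order(E)^↣_{a → b}` of factorizations
`a → x → b` (all arrows of `Order(E)` are monomorphisms) is equivalent to `Order([a, b])`, via
`(a → x → b) ↦ x`. [cite: MochizukiFrdII2008, §0 p.6] -/
theorem nonempty_monoFactorisations_equivalence_Icc {a b : E} (φ : a ⟶ b) :
    Nonempty (MonoFactorisations φ ≌ Set.Icc a b) := by
  let Φ : MonoFactorisations φ ⥤ Set.Icc a b :=
    { obj := fun F => ⟨F.obj.mid, F.obj.ι.le, F.obj.π.le⟩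
      map := fun ψ => homOfLE (show _ ≤ _ from ψ.hom.h.le)
      map_id := fun _ => Subsingleton.elim _ _
      map_comp := fun _ _ => Subsingleton.elim _ _ }
  haveI : Φ.Faithful :=
    { map_injective := fun {F G} ψ ψ' _ => by
        apply ObjectProperty.hom_ext
        apply Factorisation.Hom.ext
        exact Subsingleton.elim _ _ }
  haveI : Φ.Full :=
    { map_surjective := fun {F G} f =>
        ⟨ObjectProperty.homMk
            { h := homOfLE (show F.obj.mid ≤ G.obj.mid from f.le)
              ι_h := Subsingleton.elim _ _
              h_π := Subsingleton.elim _ _ },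
          Subsingleton.elim _ _⟩ }
  haveI : Φ.EssSurj :=
    { mem_essImage := fun x =>
        ⟨⟨{ mid := x.1, ι := homOfLE x.2.1, π := homOfLE x.2.2, ι_π := Subsingleton.elim _ _ },
            ⟨⟨fun _ _ _ => Subsingleton.elim _ _⟩, ⟨fun _ _ _ => Subsingleton.elim _ _⟩⟩⟩,
          ⟨Iso.refl _⟩⟩ }
  haveI : Φ.IsEquivalence := {}
  exact ⟨Φ.asEquivalence⟩

/-- In `Order(E)` every arrow `a → b` is a totally ordered monomorphism, with
`Order(E)^↣_{a → b} ≃ Order([a, b])`. [cite: MochizukiFrdII2008, §0 p.6] -/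
theorem isTotallyOrderedHom_of_linearOrder {a b : E} (φ : a ⟶ b) : IsTotallyOrderedHom φ :=
  ⟨⟨fun _ _ _ => Subsingleton.elim _ _⟩, Set.Icc a b, inferInstance,
    nonempty_monoFactorisations_equivalence_Icc φ⟩

/-- In `Order(E)` with `E` densely ordered every arrow `a → b` is continuously ordered: the interval
`[a, b]` is again densely ordered. [cite: MochizukiFrdII2008, §0 p.6] -/
theorem isContinuouslyOrderedHom_of_denselyOrdered [DenselyOrdered E] {a b : E} (φ : a ⟶ b) :
    IsContinuouslyOrderedHom φ :=
  ⟨⟨fun _ _ _ => Subsingleton.elim _ _⟩, Set.Icc a b, inferInstance, inferInstance,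
    nonempty_monoFactorisations_equivalence_Icc φ⟩

variable (E)

/-- **F-2333, a model category:** for a totally ordered set `E`, the category `Order(E)` is of totally
ordered type. [cite: MochizukiFrdII2008, §0 p.6] -/
theorem isOfTotallyOrderedType_of_linearOrder : IsOfTotallyOrderedType E :=
  ⟨fun φ => isTotallyOrderedHom_of_linearOrder φ⟩

/-- **F-2334, a model category:** for a totally ordered set `E`, the category `Order(E)` is of
quasi-totally ordered type. [cite: MochizukiFrdII2008, §0 p.6] -/
theorem isOfQuasiTotallyOrderedType_of_linearOrder : IsOfQuasiTotallyOrderedType E :=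
  (isOfTotallyOrderedType_of_linearOrder E).isOfQuasiTotallyOrderedType

/-- For a densely totally ordered set `E`, the category `Order(E)` is of continuously ordered type
(hence again of totally ordered type by `IsOfContinuouslyOrderedType.isOfTotallyOrderedType`).
[cite: MochizukiFrdII2008, §0 p.6] -/
theorem isOfContinuouslyOrderedType_of_denselyOrdered [DenselyOrdered E] :
    IsOfContinuouslyOrderedType E :=
  ⟨fun φ => isContinuouslyOrderedHom_of_denselyOrdered φ⟩

end Order

end Literature.AlgebraicGeometry.Frobenioids
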